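import Summits.QuantumFields.YangMills.Theorems.BalabanUVNodesN15SiteCurvedKnitMassless
import Summits.QuantumFields.YangMills.Theorems.BalabanUVNodesN15KingModelCurvedKnitFieldClosed
import HarnessLib

/-!
# Route «BalabanUVNodes», cluster K4 «SpineRates» — node N15 = NE2: THE SITE LAYER WITH THE BACKGROUND LIVE IN THE TwoGrid ENTRY CURRENCY, XXXII — THE CURVED-DRESSED LAYER's
# TWO-GRID η-DEFECT WITH THE NEUMANN SMALLNESS DISCHARGED, ON THE CLOSED MASS RANGE: King's propagator `⊗ 1` (incl. the MASSLESS site propagator `G′ ⊗ 1`) dressed by `Ad(e^{η′A′(x)})`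
# for a small, slowly varying skew-Hermitian `A′` — `𝔇(X̂′, X̂) ≤ C·((L^K)^{−γ∕2} + (L^K)^{−α})·e^{−(δ∕2)d}` with NOTHING displayed but the potential's three small-field bounds
# (the sixth of part XXII's dressed letters, for the exact-transporter edition of this seat's coloured site layer)

Cell `pub-ymgap`, WIDTH SEAT `pub-ymgap-dag-n15-w1` (generation 4; director-ym №197 ∕ HUMAN RULING D-0149; chair R455 (A) ∕ R461; dag-lead KEY MAP v2 INBOX l.35754; sequel (2) of CLAIM-1
l.37310, CLAIM-2 l.37613).  `bears_on: R4∕N15 · K3⁸ SpineGivenEndpointR13SepCoPHV (stmt-QuantumFields-27366; K3⁷ 20544 aside = lineage)`.  Filed `--kind proof --supports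
stmt-QuantumFields-27366 --as helper` — COUNT-NEUTRAL.  THEOREMS ONLY (0 `def`, 0 `sorry`).  Imports BY NAME this seat's part XXX `…N15SiteCurvedKnitMassless`
(`uN_hasMaj_idef_curvDressed_kingTorus_king_field_massRange` = dag-n15-w2's Ω-f §2 on `0 ≤ m² ≤ m₀²`) and dag-n15-w2's `…KingModelCurvedKnitFieldClosed` (p608614: `expRowLetter_field_le`,
`expFitLetter_field_le`, `expFitLetter_field_eq`, `knitFieldConst_le`; dag-n15-e Ω-c `knitConst_le`; p599926 `basisConst_le_sqrt_card_of_traceForm`); nothing in the tree is modified.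

WHY.  dag-n15-w2's `uN_hasMaj_idef_curvDressed_kingTorus_king_field_closed` is the HYPOTHESIS-FREE η-rate statement of the curved knit for a small `𝔲(N)` field — but on the OPEN mass range
`0 < m² ≤ m₀²` (King's model being massive).  The site layer of record is massless ([Balaban1984PropagatorsI] p. 25, this seat's part VII); part XXX took Ω-f to the closed range, and THIS
FILE re-runs dag-n15-w2's closed edition on it VERBATIM (credited): the smallness `β·R_V·c_r ≤ ½` DISCHARGED by `R_V(2a₀, 0, 2a₀) ≤ 2a₀·S` + `κ_e ≤ √|κ|`, the fit letter ABSORBED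
(`≤ L^{−K}·Φ ≤ ((L^K)^{−γ∕2} + (L^K)^{−α})·Φ`).  It is the two-grid defect letter of part XXII's `siteLettersC_of_sizedDressedLetters` for the exact-transporter edition (sizes and increments:
part XXXI `…N15SiteCurvedDressedSizes`).

CONTENTS.  ★★ `uN_hasMaj_idef_curvDressed_kingTorus_king_field_closed_massRange` — `∃ δ C a₀ > 0`: for EVERY `K ≥ 1`, cube `2L^e`, `0 ≤ m² ≤ m₀²`, `Msz`, every skew-Hermitian `A′` with
`‖A′‖ ≤ a₀`, `‖A′(y′) − A′(y′ − e_ν)‖ ≤ η′a₀`, `‖∇_ν∇_μA′‖ ≤ η′a₀`: the η-defect of the curved dressed pairs (fine `Ad(e^{η′A′})`, coarse block-mean transporter) `≤ C·((L^K)^{−γ∕2} + (L^K)^{−α})·e^{−(δ∕2)|y−y′|_T}`.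

HONEST FRAMING ∕ LIMITS.  Count-neutral; a proof re-run on the closed mass range; no new analytic estimate.  King's `A = 0` MODEL propagator at the FLAT base point dressed by the exact
adjoint transporter of a small potential (coarse potential = block mean, not (3.8)); ONE blocking step; NOT Bałaban's `G(U)` at a (3.35)-regular `U` of the datum; nothing of [B5]∕[B6]∕[B9]
asserted ((3.35)–(3.37) p. 396, (3.50) p. 400, Thm 3.1 (3.42) p. 397, (3.63)–(3.65) pp. 402–403 = SHAPES ∕ MECHANISM; [King1986] Prop. 3.9 (3.73) p. 665, (4.1)–(4.5) p. 670 = TEMPLATE).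
NE2⁺ NOT PRINTED ∕ NOT proved for d = 4; **N15 is NOT discharged**; K3⁸ OPEN, not claimed, skeleton v6 untouched; counts of record UNMOVED (typed 28∕28 · discharged 5∕27, A 5∕28); no
summit statement is proved here; one finite four-torus programme at fixed `ε` — NOT ℝ⁴, NOT infinite volume, NOT OS, NOT a mass gap, NOT Clay; R4 closes the conditional finite-𝕋⁴ rung
`BalabanLadder.UV` only.  Restate-immune (no Theses import).
-/

set_option autoImplicit false

noncomputable section
open scoped BigOperators Matrix Matrix.Norms.Frobenius Topology

namespace Summit.QuantumFields.YangMills.BalabanUVNodes.N15.SiteLayerBg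

open Real Finset NormedSpace Filter
open Literature.MathematicalPhysics.QuantumFieldTheory.Balaban1983to89
open Literature.MathematicalPhysics.QuantumFieldTheory.Balaban1983to89.B11SectG (BlockNorm HasMaj RowSum)
open Literature.MathematicalPhysics.QuantumFieldTheory.Balaban1983to89.B6RandomWalk (Triangle254)
open Literature.MathematicalPhysics.QuantumFieldTheory.Balaban1983to89.B6UnitTorusCarrier (unitTorusGeo triangle254_unitTorusGeo rowSum_unitTorusGeo)
open Literature.MathematicalPhysics.QuantumFieldTheory.Balaban1983to89.T4EtaRateDefect (idef idef_apply idef_comp)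
open Literature.MathematicalPhysics.QuantumFieldTheory.Balaban1983to89.T4EtaRateCoeffDefect (pull pull_apply)
open Literature.MathematicalPhysics.QuantumFieldTheory.Balaban1983to89.B5Prop11Plancherel (Tor fine unitVec)
open Literature.MathematicalPhysics.QuantumFieldTheory.King1986 (aK aK_pos)
open Literature.MathematicalPhysics.QuantumFieldTheory.King1986.Torus (fineOp blockOf tdistT tdistT_nonneg)
open Literature.MathematicalPhysics.QuantumFieldTheory.Balaban1983to89.Beta.AveragingCorrectionJets (adCLM norm_adCLM_le adCLM_smul)
open Literature.Barriers.QuantumFields (traceForm)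
open Summit.QuantumFields.YangMills.BalabanUVNodes.N15.VectorPiece (unitTorusGeoS tensorId tensorId_apply hasMaj_tensorId idef_tensorId)
open Summit.QuantumFields.YangMills.BalabanUVNodes.N15.MatrixSpecies (liftMap liftBlk liftEquiv liftEquiv_apply liftEquiv_symm_apply coordMat coordMat_sub basisConst
  basisConst_nonneg Phi0 adCLM_sub)
open Summit.QuantumFields.YangMills.BalabanUVNodes.N15.BackgroundLayer (fgrad bgrad liftPair blkPair projO coordMat_smul coordMat_one hasMaj_projO_comp)
open Summit.QuantumFields.YangMills.BalabanUVNodes.N15.CurvedSpecies (torStep blockMeanField blockMeanTV covPieces covPieces_one gaugePair gaugePair_one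
  curvDressed expTrField expTrField_apply expRowLetter expFitLetter curvRowLetter torStep_symm_apply coordMat_adCLM_transpose_eq_neg_of_conjTranspose
  expRowLetter_nonneg expRowLetter_field_le expRowLetter_field_eq expFitLetter_field_le expFitLetter_field_eq knitFieldConst_le basisConst_le_sqrt_card_of_traceForm)
open Summit.QuantumFields.YangMills.BalabanUVNodes.N15KingModelRung.Curved

variable {d : ℕ} (L : ℕ) [NeZero L]
variable {n : Type} [Fintype n] [DecidableEq n] {κ : Type} [Fintype κ] [DecidableEq κ] (e : Matrix n n ℂ ≃L[ℝ] (κ → ℝ))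

/-! ## ★★ The two-grid η-defect with the smallness discharged, on the closed mass range -/

section Closed

/-- ★★ **dag-n15-w2's CLOSED η-RATE STATEMENT ON THE CLOSED MASS RANGE `0 ≤ m² ≤ m₀²`.**  For odd `L ≥ 3`, `a > 0`, `m₀² ≥ 0`, `0 < γ < 1`, `0 < α < 1` and trace-form-orthonormal
coordinates `e` of `M_N(ℂ)` there are `δ, C, a₀ > 0` such that for EVERY `K ≥ 1`, cube `2L^e`, mass `0 ≤ m² ≤ m₀²` (the massless site propagator included), size datum, and EVERY skew-Hermitian
lattice gauge field `A′` on the fine torus with `‖A′_μ(y′)‖ ≤ a₀`, `‖A′_μ(y′) − A′_μ(y′ − e_ν)‖ ≤ η′a₀`, `‖∇_ν∇_μ A′‖ ≤ η′a₀`: the η-defect of the curved dressed pairs of King's full `A = 0`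
propagator `⊗ 1` — dressed by `Ad(e^{η′A′(x)})` on the fine torus and by the block-mean transporter on the coarse one — has the block majorant `C·((L^K)^{−γ∕2} + (L^K)^{−α})·e^{−(δ∕2)|y−y′|_T}`
(proof = `…KingModelCurvedKnitFieldClosed`'s verbatim, reading part XXX §3 instead of Ω-f §2: smallness DISCHARGED by `expRowLetter_field_le` + `κ_e ≤ √|κ|`, fit ABSORBED by
`expFitLetter_field_le`). [cite: Balaban1985BackgroundPropagators, (3.35)–(3.37) p.396, (3.50) p.400 (shapes), Thm 3.1 (3.42) p.397 (η-rate shape), (3.63)–(3.65) pp.402–403 (mechanism); King1986, Prop. 3.9 (3.73) p.665 (template); Balaban1984PropagatorsI, p.25 (massless `G′`)] -/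
theorem uN_hasMaj_idef_curvDressed_kingTorus_king_field_closed_massRange (he : ∀ X Y : Matrix n n ℂ, traceForm X Y = e X ⬝ᵥ e Y) (hLodd : Odd L) (hL : 2 ≤ L) {a : ℝ} (ha : 0 < a)
    {m0sq : ℝ} (hm0 : 0 ≤ m0sq) {γ : ℝ} (hγ0 : 0 < γ) (hγ1 : γ < 1) {α : ℝ} (hα0 : 0 < α) (hα1 : α < 1) :
    ∃ δ C a₀ : ℝ, 0 < δ ∧ 0 < C ∧ 0 < a₀ ∧ ∀ (K : ℕ), 1 ≤ K → ∀ (ex : ℕ) (M : Fin (d + 1) → ℕ) [∀ μ, NeZero (M μ)], (∀ μ, M μ = 2 * L ^ ex) →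
      ∀ (msq : ℝ), 0 ≤ msq → msq ≤ m0sq → ∀ (Msz : ℝ) (A' : Fin (d + 1) → Tor (fine L (fine (L ^ K) M)) → Matrix n n ℂ),
      (∀ μ y', ‖A' μ y'‖ ≤ a₀) →
      (∀ μ ν y', ‖A' μ y' - A' μ (y' - unitVec (fine L (fine (L ^ K) M)) ν)‖ ≤ ((L : ℝ) ^ (K + 1))⁻¹ * a₀) →
      (∀ μ ν (z' : Tor (fine L (fine (L ^ K) M))), ‖(((L : ℝ) ^ (K + 1))⁻¹)⁻¹ • (A' μ (z' + unitVec (fine L (fine (L ^ K) M)) ν + unitVec (fine L (fine (L ^ K) M)) μ) -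
          A' μ (z' + unitVec (fine L (fine (L ^ K) M)) ν)) - (((L : ℝ) ^ (K + 1))⁻¹)⁻¹ • (A' μ (z' + unitVec (fine L (fine (L ^ K) M)) μ) - A' μ z')‖ ≤ ((L : ℝ) ^ (K + 1))⁻¹ * a₀) →
      (∀ μ y', (A' μ y')ᴴ = -A' μ y') →
    HasMaj (BlockNorm.ofBlocks (unitTorusGeoS L K M Msz) (liftBlk (blockOf (L ^ K) M) κ)) (BlockNorm.ofBlocks (unitTorusGeoS L K M Msz) (blkPair (liftBlk (blockOf (L ^ K) M ∘ blockOf L (fine (L ^ K) M)) κ)))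
      (idef (pull (liftMap (blockOf L (fine (L ^ K) M)) κ)) (pull (liftPair (liftMap (blockOf L (fine (L ^ K) M)) κ)))
        (curvDressed ((L : ℝ) ^ (K + 1))⁻¹ (torStep (fine L (fine (L ^ K) M))) (expTrField e ((L : ℝ) ^ (K + 1))⁻¹ 0) (expTrField e ((L : ℝ) ^ (K + 1))⁻¹ (fun μ y' => adCLM ℝ (A' μ y'))) (kingGT₁ L a msq K M κ))
        (curvDressed ((L : ℝ) * ((L : ℝ) ^ (K + 1))⁻¹) (torStep (fine (L ^ K) M)) (expTrField e ((L : ℝ) * ((L : ℝ) ^ (K + 1))⁻¹) (blockMeanField L (fine (L ^ K) M) 0)) (expTrField e ((L : ℝ) * ((L : ℝ) ^ (K + 1))⁻¹) (blockMeanField L (fine (L ^ K) M) (fun μ y' => adCLM ℝ (A' μ y')))) (kingGT L a msq K M κ)))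
        (fun y y' => C * (((L : ℝ) ^ K) ^ (-(γ / 2)) + ((L : ℝ) ^ K) ^ (-α)) * Real.exp (-(δ / 2 * tdistT M y y'))) := by
  obtain ⟨β, δ, m, hβ, hδ, hm, H⟩ := uN_hasMaj_idef_curvDressed_kingTorus_king_field_massRange (d := d) L e he hLodd hL ha hm0 hγ0 hγ1 hα0 hα1
  -- level-independent letters: `c_r`, `c_d = 1 + |J ⊕ J|`, `s = √|κ| ≥ κ_e`, `d′ = d + 1`, the row slope `S`, the fit constant `Φ`, `D = 4β(S c_d)c_r + 1`
  have hexp : 0 ≤ Real.exp 1 := Real.exp_nonneg 1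
  have hc : 0 ≤ B4Sect5Proof.latticeConst (d + 1) (δ / 2) := B4Sect5Proof.latticeConst_nonneg (d + 1) (half_pos hδ).le
  have hcd : (0 : ℝ) ≤ 1 + Fintype.card (Fin (d + 1) ⊕ Fin (d + 1)) := by positivity
  have hk : (0 : ℝ) ≤ Fintype.card κ := Nat.cast_nonneg _
  have hdJ : (0 : ℝ) ≤ Fintype.card (Fin (d + 1)) := Nat.cast_nonneg _
  have hd' : (0 : ℝ) ≤ ((d + 1 : ℕ) : ℝ) := Nat.cast_nonneg _
  have hs : 0 ≤ Real.sqrt (Fintype.card κ) := Real.sqrt_nonneg _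
  have hκ0 : 0 ≤ basisConst e := basisConst_nonneg e
  have hκs : basisConst e ≤ Real.sqrt (Fintype.card κ) := basisConst_le_sqrt_card_of_traceForm e he
  obtain ⟨S, hS_def⟩ : ∃ S : ℝ, S = Real.sqrt (Fintype.card κ) * Real.exp 1 * ((Fintype.card κ : ℝ) + (Fintype.card κ : ℝ) ^ 3) +
      (Fintype.card κ : ℝ) * ((Fintype.card (Fin (d + 1)) : ℝ) * ((Fintype.card κ : ℝ) * (Real.sqrt (Fintype.card κ) * Real.exp 1) ^ 2 + Real.sqrt (Fintype.card κ) * Real.exp 1)) := ⟨_, rfl⟩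
  have hS : 0 ≤ S := by rw [hS_def]; positivity
  obtain ⟨P, hP_def⟩ : ∃ P : ℝ, P = (Fintype.card κ : ℝ) * (Real.sqrt (Fintype.card κ) * (Real.exp 1 * ((d + 1 : ℕ) : ℝ) + 2 * Real.exp 1)) +
        (Fintype.card κ : ℝ) ^ 3 * (Real.sqrt (Fintype.card κ) * (Real.exp 1 * (((d + 1 : ℕ) : ℝ) + 1) + 2 * Real.exp 1)) +
        (Fintype.card κ : ℝ) * ((Fintype.card (Fin (d + 1)) : ℝ) * (2 * (Fintype.card κ : ℝ) * (Real.sqrt (Fintype.card κ) * (Real.exp 1 * ((d + 1 : ℕ) : ℝ) + 2 * Real.exp 1)) *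
          (Real.sqrt (Fintype.card κ) * Real.exp 1) + Real.sqrt (Fintype.card κ) * ((((d + 1 : ℕ) : ℝ) + 1) + 2 * Real.exp 1))) := ⟨_, rfl⟩
  have hP : 0 ≤ P := by rw [hP_def]; positivity
  have hΦ : 0 ≤ P * (1 + Fintype.card (Fin (d + 1) ⊕ Fin (d + 1))) := mul_nonneg hP hcd
  obtain ⟨D, hD_def⟩ : ∃ D : ℝ, D = 4 * β * (S * (1 + Fintype.card (Fin (d + 1) ⊕ Fin (d + 1)))) * B4Sect5Proof.latticeConst (d + 1) (δ / 2) + 1 := ⟨_, rfl⟩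
  have hD : 0 < D := by rw [hD_def]; positivity
  refine ⟨δ, 2 * B4Sect5Proof.latticeConst (d + 1) (δ / 2) * m + 2 * m + 4 * B4Sect5Proof.latticeConst (d + 1) (δ / 2) * β ^ 2 * (P * (1 + Fintype.card (Fin (d + 1) ⊕ Fin (d + 1)))) + 1, min (1 / 2) (1 / (2 * D)), hδ,
    by positivity, lt_min (by norm_num) (by positivity), fun K hK ex M _ hM msq hmsq hcap Msz A' hA hgradA hsecA hAs => ?_⟩
  -- the small-field bound `a₀ = min (1∕2) (1∕(2D))`: `t = 2a₀ ≤ 1`, `t ≤ 1∕D`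
  have ha0 : 0 ≤ min (1 / 2 : ℝ) (1 / (2 * D)) := (lt_min (by norm_num : (0 : ℝ) < 1 / 2) (by positivity : (0 : ℝ) < 1 / (2 * D))).le
  have ht1 : 2 * min (1 / 2 : ℝ) (1 / (2 * D)) ≤ 1 := by have h := min_le_left (1 / 2 : ℝ) (1 / (2 * D)); linarith
  have htD : 2 * min (1 / 2 : ℝ) (1 / (2 * D)) ≤ 1 / D := by
    have h := min_le_right (1 / 2 : ℝ) (1 / (2 * D))
    have e1 : 2 * (1 / (2 * D)) = 1 / D := by field_simp
    linarith
  have ht0 : 0 ≤ 2 * min (1 / 2 : ℝ) (1 / (2 * D)) := by positivity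
  -- the Neumann smallness HOLDS (`βR_Vc_dc_r ≤ ½ < 1`)
  have hR : expRowLetter κ (Fin (d + 1)) (basisConst e) (2 * min (1 / 2 : ℝ) (1 / (2 * D))) 0 (2 * min (1 / 2 : ℝ) (1 / (2 * D))) * (1 + Fintype.card (Fin (d + 1) ⊕ Fin (d + 1))) ≤
      2 * min (1 / 2 : ℝ) (1 / (2 * D)) * (S * (1 + Fintype.card (Fin (d + 1) ⊕ Fin (d + 1)))) := by
    rw [← mul_assoc]
    refine mul_le_mul_of_nonneg_right ?_ hcd
    rw [hS_def]
    exact expRowLetter_field_le κ (Fin (d + 1)) hκ0 hκs ht0 ht1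
  have hq2 : β * (expRowLetter κ (Fin (d + 1)) (basisConst e) (2 * min (1 / 2 : ℝ) (1 / (2 * D))) 0 (2 * min (1 / 2 : ℝ) (1 / (2 * D))) *
      (1 + Fintype.card (Fin (d + 1) ⊕ Fin (d + 1)))) * B4Sect5Proof.latticeConst (d + 1) (δ / 2) ≤ 1 / 2 := by
    have hT : 0 ≤ S * (1 + Fintype.card (Fin (d + 1) ⊕ Fin (d + 1))) := mul_nonneg hS hcd
    have h1 : β * (expRowLetter κ (Fin (d + 1)) (basisConst e) (2 * min (1 / 2 : ℝ) (1 / (2 * D))) 0 (2 * min (1 / 2 : ℝ) (1 / (2 * D))) *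
        (1 + Fintype.card (Fin (d + 1) ⊕ Fin (d + 1)))) * B4Sect5Proof.latticeConst (d + 1) (δ / 2) ≤
        β * (1 / D * (S * (1 + Fintype.card (Fin (d + 1) ⊕ Fin (d + 1))))) * B4Sect5Proof.latticeConst (d + 1) (δ / 2) := by
      exact mul_le_mul_of_nonneg_right (mul_le_mul_of_nonneg_left (hR.trans (mul_le_mul_of_nonneg_right htD hT)) hβ.le) hc
    have h2 : β * (1 / D * (S * (1 + Fintype.card (Fin (d + 1) ⊕ Fin (d + 1))))) * B4Sect5Proof.latticeConst (d + 1) (δ / 2) =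
        (β * (S * (1 + Fintype.card (Fin (d + 1) ⊕ Fin (d + 1)))) * B4Sect5Proof.latticeConst (d + 1) (δ / 2)) / D := by ring
    have h3 : (β * (S * (1 + Fintype.card (Fin (d + 1) ⊕ Fin (d + 1)))) * B4Sect5Proof.latticeConst (d + 1) (δ / 2)) / D ≤ 1 / 2 := by
      rw [div_le_iff₀ hD, hD_def]; nlinarith [mul_nonneg (mul_nonneg hβ.le hT) hc]
    linarith
  have key := H K hK ex M hM msq hmsq hcap Msz A' (min (1 / 2) (1 / (2 * D))) (min (1 / 2) (1 / (2 * D))) (min (1 / 2) (1 / (2 * D))) ha0 ht1 ha0 ha0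
    hA hgradA hsecA hAs (by linarith)
  refine key.mono fun y y' => mul_le_mul_of_nonneg_right ?_ (Real.exp_nonneg _)
  -- letters of the level
  have hL1 : (1 : ℝ) ≤ (L : ℝ) := by exact_mod_cast (show 1 ≤ L by omega)
  have hL0 : (0 : ℝ) < (L : ℝ) := by positivity
  have hθ : 0 ≤ ((L : ℝ) ^ K) ^ (-(γ / 2)) + ((L : ℝ) ^ K) ^ (-α) :=
    add_nonneg (Real.rpow_nonneg (pow_nonneg hL0.le _) _) (Real.rpow_nonneg (pow_nonneg hL0.le _) _)
  have hmθ : 0 ≤ m * (((L : ℝ) ^ K) ^ (-(γ / 2)) + ((L : ℝ) ^ K) ^ (-α)) := mul_nonneg hm.le hθ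
  have hη0 : 0 ≤ (L : ℝ) * ((L : ℝ) ^ (K + 1))⁻¹ := by positivity
  have hηθ : (L : ℝ) * ((L : ℝ) ^ (K + 1))⁻¹ ≤ ((L : ℝ) ^ K) ^ (-(γ / 2)) + ((L : ℝ) ^ K) ^ (-α) := by
    have h1 : (L : ℝ) * ((L : ℝ) ^ (K + 1))⁻¹ = ((L : ℝ) ^ K)⁻¹ := by
      rw [pow_succ, mul_inv, ← mul_assoc, mul_comm (L : ℝ), mul_assoc, mul_inv_cancel₀ hL0.ne', mul_one]
    rw [h1, ← Real.rpow_neg_one]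
    exact (Real.rpow_le_rpow_of_exponent_le (one_le_pow₀ hL1) (by linarith)).trans (le_add_of_nonneg_left (Real.rpow_nonneg (pow_nonneg hL0.le _) _))
  -- the row letter and the fit letter at the small field
  have hR0 : 0 ≤ expRowLetter κ (Fin (d + 1)) (basisConst e) (2 * min (1 / 2 : ℝ) (1 / (2 * D))) 0 (2 * min (1 / 2 : ℝ) (1 / (2 * D))) *
      (1 + Fintype.card (Fin (d + 1) ⊕ Fin (d + 1))) := mul_nonneg (expRowLetter_nonneg (ι := κ) (J := Fin (d + 1)) hκ0 ht0 le_rfl ht0) hcd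
  have h1 := expFitLetter_field_le κ (Fin (d + 1)) (η := (L : ℝ) * ((L : ℝ) ^ (K + 1))⁻¹) (d' := ((d + 1 : ℕ) : ℝ)) hκ0 hκs ht0 ht1 hη0 hd'
  rw [← hP_def] at h1
  have hF := calc _ ≤ (L : ℝ) * ((L : ℝ) ^ (K + 1))⁻¹ * P * (1 + Fintype.card (Fin (d + 1) ⊕ Fin (d + 1))) := mul_le_mul_of_nonneg_right h1 hcd
    _ = P * (1 + Fintype.card (Fin (d + 1) ⊕ Fin (d + 1))) * ((L : ℝ) * ((L : ℝ) ^ (K + 1))⁻¹) := by ring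
    _ ≤ P * (1 + Fintype.card (Fin (d + 1) ⊕ Fin (d + 1))) * (((L : ℝ) ^ K) ^ (-(γ / 2)) + ((L : ℝ) ^ K) ^ (-α)) := mul_le_mul_of_nonneg_left hηθ hΦ
  have hF0 : 0 ≤ expFitLetter κ (Fin (d + 1)) (basisConst e) (2 * min (1 / 2 : ℝ) (1 / (2 * D))) 0 (2 * min (1 / 2 : ℝ) (1 / (2 * D)))
      (((d + 1 : ℕ) : ℝ) * ((L : ℝ) * ((L : ℝ) ^ (K + 1))⁻¹) * (2 * min (1 / 2 : ℝ) (1 / (2 * D))))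
      (((d + 1 : ℕ) : ℝ) * ((L : ℝ) * ((L : ℝ) ^ (K + 1))⁻¹) * (2 * min (1 / 2 : ℝ) (1 / (2 * D))) + (L : ℝ) * ((L : ℝ) ^ (K + 1))⁻¹ * (2 * min (1 / 2 : ℝ) (1 / (2 * D))))
      (((d + 1 : ℕ) : ℝ) * ((L : ℝ) * ((L : ℝ) ^ (K + 1))⁻¹) * 0 + (L : ℝ) * ((L : ℝ) ^ (K + 1))⁻¹ * 0)
      ((((d + 1 : ℕ) : ℝ) + 1) * ((L : ℝ) * ((L : ℝ) ^ (K + 1))⁻¹) * (2 * min (1 / 2 : ℝ) (1 / (2 * D)))) ((L : ℝ) * ((L : ℝ) ^ (K + 1))⁻¹) *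
      (1 + Fintype.card (Fin (d + 1) ⊕ Fin (d + 1))) := by
    refine mul_nonneg ?_ hcd
    rw [expFitLetter_field_eq]
    positivity
  exact (knitConst_le hmθ hc hR0 hβ.le hF0 hq2).trans (knitFieldConst_le hc hm.le hθ hF hq2)

end Closed

end Summit.QuantumFields.YangMills.BalabanUVNodes.N15.SiteLayerBg

end
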